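import Mathlib
import HarnessLib
import Summits.NavierStokesRegularity.NavierStokesRegularity.Theorems.PoloidalWindowDoorLrcModEntireGraphTransport
import Summits.NavierStokesRegularity.NavierStokesRegularity.Theorems.PoloidalWindowDoorLrcModEntireQ4WebPackage
import Summits.NavierStokesRegularity.NavierStokesRegularity.Theorems.PoloidalWindowDoorLrcModEntireRidgeWebLawHoriz

/-!
# Route `PoloidalWindowDoor`, item `LrcModEntire` (stmt-NavierStokesRegularity-20428), cell (Q4-sonic, straight, μ < 0) `stub_Q4sonicLineNeg`, case I —
# BRICK B-T IN BINDER CURRENCY: AT A SONIC TIME THE WEBS ARE `e`-PARALLEL LINES AND `d_z² = −μ(−1+τ,·)`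

Cell ns-regularity-ideate, stub-worker seat ns-poloidal-K2-p2 g16 under the LEAD of item 20428 (ns-poloidal-K2-p3 g17);
`--supports stmt-NavierStokesRegularity-20428 --as helper`.  Memo `Cruxes/LrcModEntire/T2B-g17.md` v2 §1 (case I) / §5(5g): «B-T (K2-p2; M): pin-free, hot-free
τ-version of the transport argument: (Q4 binders) ∧ Γ line ∧ R(τ,·) affine at a time τ ⇒ the maximiser `n₀(τ,s,z)` is s-free (webs at time −1+τ are e-parallel
lines), `d(τ,·)` with `d_z² = −μ(−1+τ,·)`.»  This file is the τ-instantiation of the class-free `…GraphTransport.sfree_of_sonic_sheet` over the (Q4) binders: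

★ `sonic_webs_parallel` — class, poloidal, slab slope form `hslabU` (`|t+1| < ρ`), the web Fermat law `hweb` and strict concavity `hconc` on the window
`|τ|,|z| < δ` over a STRAIGHT branch `Γ s = s·Γ′(0)`; a time `τ` with `|τ| < δ, ρ, 1/2`, SONIC at `τ` (`R(τ,·)` affine on `|z| < δ`) and `μ(−1+τ, 0) < 0`
⊢ a height window `δ' > 0` and an offset `d` with: for all `s` and `|z| < δ'` the unique cross-section maximiser at `(τ, s, z)` is `d z` (value `R(τ,z)`,
strict elsewhere on `[−r, r]`) — the webs at time `−1+τ` are the `e`-PARALLEL LINES `s·e + d(z)·Je + z·e₂` — and `d` is differentiable with `d′(z)² = −μ(−1+τ, z)`.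
Inputs at time `−1+τ` (all τ₀-general tree lemmas): web function `webFun` (+ `contDiffAt_webFun`, C^ω IFT), web data `webData_of_fderiv_uncurry`, horizontal
ridge law `horizLaplacian_two_eq_of_webFermat` ((TH) vertical equation; the ridge law is `s`-free WITHOUT hot normalisation), slice law `plane_wave_identity`,
joint smoothness `contDiffOn_uncurry_signed`; then `sfree_of_sonic_sheet` (graph transport law, p739114/`…GraphTransport`).
* `sonic_webs_parallel_timeWeb` — the same in the currency of port-2's space–time web function `n₀(τ,s,z)` (`…Q4TimeWebPackage.time_web_package_line`):
  «PARALLEL AT τ: `n₀(τ,s,z) = n₀(τ,0,z)` for `|z| < δ₁`» — the literal hypothesis of port-2's A-SPEED(τ) package (LEAD GO 18:51:51Z).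

WHAT THIS IS NOT: not a claim about Navier–Stokes regularity — the kernel form of one step (B-T) of LEAD's case-I chain for the research slot `stub_Q4sonicLineNeg`
(A-I assembles: B-T + sheet data + (CK2) + HorizontalGerm/HorizontalPeriod); items 20428 / 19708 / 27893 OPEN (bears_on LADDER-NS N0).
-/

noncomputable section

-- the summit and its single sub-problem share the name (CONVENTIONS §1), as in every Theorems file
set_option linter.dupNamespace false

namespace Summit.NavierStokesRegularity.NavierStokesRegularity.Theorems.PoloidalWindowDoorLrcModEntireSonicWebsParallel

open Set Function Filter Topology Metric
open scoped RealInnerProductSpace InnerProductSpace Laplacian ContDiff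
open Literature.Analysis Literature.Analysis.FluidPDE Literature.Analysis.UnboundedOperators
open Summit.NavierStokesRegularity.NavierStokesRegularity.Theorems.PoloidalWindowDoorLrcModEntireSheetFlattenTools
open Summit.NavierStokesRegularity.NavierStokesRegularity.Theorems.PoloidalWindowDoorLrcModEntireQ4LineTools
open Summit.NavierStokesRegularity.NavierStokesRegularity.Theorems.PoloidalWindowDoorLrcModEntireQ4LineWeb
open Summit.NavierStokesRegularity.NavierStokesRegularity.Theorems.PoloidalWindowDoorLrcModEntireParallelWebsIdentity
open Summit.NavierStokesRegularity.NavierStokesRegularity.Theorems.PoloidalWindowDoorLrcModEntireParallelWebs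
open Summit.NavierStokesRegularity.NavierStokesRegularity.Theorems.PoloidalWindowDoorLrcModEntireRidgeWebLaw
open Summit.NavierStokesRegularity.NavierStokesRegularity.Theorems.PoloidalWindowDoorLrcModEntireRidgeWebLawHoriz
open Summit.NavierStokesRegularity.NavierStokesRegularity.Theorems.PoloidalWindowDoorLrcModEntireRidgeClassConstants
open Summit.NavierStokesRegularity.NavierStokesRegularity.Theorems.PoloidalWindowDoorPoloidalWindowRigidityTimeHeightShearLinearSlice
open Summit.NavierStokesRegularity.NavierStokesRegularity.Theorems.PoloidalWindowDoorPoloidalWindowRigidityConstantShearSlice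
open Summit.NavierStokesRegularity.NavierStokesRegularity.Theorems.LocalSineTubeDoorProfileAlignedWindowRigidityAncient
open Summit.NavierStokesRegularity.NavierStokesRegularity.Theorems.PoloidalWindowDoorLrcModEntireGraphTransport

/-- ★ **B-T: AT A SONIC TIME THE WEBS ARE `e`-PARALLEL LINES, `d′² = −μ`.**  See the module docstring. -/
theorem sonic_webs_parallel {C : ℝ} {U : ℝ → EuclideanSpace ℝ (Fin 3) → EuclideanSpace ℝ (Fin 3)} {Γ νΓ : ℝ → EuclideanSpace ℝ (Fin 3)}
    {R μ : ℝ → ℝ → ℝ} {σ r δ ρ τ : ℝ}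
    (hUrate : HasTypeITimeDecay C U) (hUcont : ContinuousOn (uncurry U) (Iio (0 : ℝ) ×ˢ univ))
    (hUmild : ∀ s t : ℝ, s < t → t < 0 → ∀ x, U t x = heatExtension (U s) (t - s) x - oseenDuhamel 1 s U U t x)
    (hUdiv : ∀ t < 0, VectorCalculus.IsDivFree (U t))
    (hUpol : ∀ s < 0, ∀ q, ⟪curl (U s) q, EuclideanSpace.single 2 1⟫_ℝ = 0)
    (hσ : σ = 1 ∨ σ = -1)
    (hΓ2 : ∀ s, Γ s 2 = 0) (hΓunit : ∀ s, ‖deriv Γ s‖ = 1)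
    (hν : ∀ s, νΓ s = WithLp.toLp 2 ![-(deriv Γ s 1), deriv Γ s 0, 0])
    (hline : ∀ s : ℝ, Γ s = s • deriv Γ 0)
    (hδ : 0 < δ)
    (hconc : ∀ τ z : ℝ, |τ| < δ → |z| < δ → ∀ s : ℝ, ∀ n ∈ Ioo (-r) r,
      fderiv ℝ (fderiv ℝ (fun y => σ * U (-1 + τ) y 2)) (Γ s + n • νΓ s + z • EuclideanSpace.single 2 (1 : ℝ)) (νΓ s) (νΓ s) < 0)
    (hweb : ∀ τ₀ z₀ : ℝ, |τ₀| < δ → |z₀| < δ → ∀ s₀ : ℝ, ∃ n₀ ∈ Ioo (-r) r,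
      σ * U (-1 + τ₀) (Γ s₀ + n₀ • νΓ s₀ + z₀ • EuclideanSpace.single 2 (1 : ℝ)) 2 = R τ₀ z₀ ∧
      (∀ n ∈ Icc (-r) r, n ≠ n₀ → σ * U (-1 + τ₀) (Γ s₀ + n • νΓ s₀ + z₀ • EuclideanSpace.single 2 (1 : ℝ)) 2 < R τ₀ z₀) ∧
      DifferentiableAt ℝ (uncurry R) (τ₀, z₀) ∧
      fderiv ℝ (uncurry fun τ y => σ * U (-1 + τ) y 2) (τ₀, Γ s₀ + n₀ • νΓ s₀ + z₀ • EuclideanSpace.single 2 (1 : ℝ)) =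
        (fderiv ℝ (uncurry R) (τ₀, z₀)).comp
          ((ContinuousLinearMap.fst ℝ ℝ (EuclideanSpace ℝ (Fin 3))).prod
            ((EuclideanSpace.proj (2 : Fin 3)).comp (ContinuousLinearMap.snd ℝ ℝ (EuclideanSpace ℝ (Fin 3))))))
    (hρ : 0 < ρ) (hμ3 : ContDiff ℝ 3 (uncurry μ))
    (hslabU : ∀ t : ℝ, |t + 1| < ρ → ∀ x : EuclideanSpace ℝ (Fin 3), |x 2| < ρ → ∀ b : Fin 3, b ≠ 2 →
      fderiv ℝ (U t) x (EuclideanSpace.single 2 1) b = μ t (x 2) * fderiv ℝ (U t) x (EuclideanSpace.single b 1) 2)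
    (hτδ : |τ| < δ) (hτρ : |τ| < ρ) (hτh : |τ| < 1 / 2)
    (hson : ∃ a b : ℝ, ∀ z : ℝ, |z| < δ → R τ z = a + b * z) (hμneg : μ (-1 + τ) 0 < 0) :
    ∃ (δ' : ℝ) (d : ℝ → ℝ), 0 < δ' ∧ δ' ≤ δ ∧
      (∀ s : ℝ, ∀ z ∈ Ioo (-δ') δ', d z ∈ Ioo (-r) r ∧
        σ * U (-1 + τ) (Γ s + d z • νΓ s + z • EuclideanSpace.single 2 (1 : ℝ)) 2 = R τ z ∧
        ∀ n ∈ Icc (-r) r, n ≠ d z → σ * U (-1 + τ) (Γ s + n • νΓ s + z • EuclideanSpace.single 2 (1 : ℝ)) 2 < R τ z) ∧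
      (∀ z ∈ Ioo (-δ') δ', DifferentiableAt ℝ d z ∧ deriv d z ^ 2 = -μ (-1 + τ) z) := by
  have ht : -1 + τ < 0 := by linarith [(abs_lt.1 hτh).2]
  have hτρ' : |(-1 + τ) + 1| < ρ := by simpa using hτρ
  obtain ⟨hΓd, he2, hunit, hνe, hpt⟩ := line_frame hline hΓ2 hΓunit hν
  set e : EuclideanSpace ℝ (Fin 3) := deriv Γ 0 with he_def
  /- STEP 1: the signed slice `F = σU₂(−1+τ,·)`, real-analytic; joint differentiability. -/
  obtain ⟨F, hF_def⟩ : ∃ F : EuclideanSpace ℝ (Fin 3) → ℝ, F = fun y => σ * U (-1 + τ) y 2 := ⟨_, rfl⟩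
  have hUan : AnalyticOnNhd ℝ (U (-1 + τ)) univ := analyticOnNhd_slice hUcont (bdd_of_hasTypeITimeDecay hUrate) hUmild ht
  have hU2 : ContDiff ℝ 2 (U (-1 + τ)) := hUan.contDiff
  have hUd : Differentiable ℝ (U (-1 + τ)) := hU2.differentiable (by norm_num)
  have hθan : AnalyticOnNhd ℝ (fun y => U (-1 + τ) y 2) univ := fun x _ =>
    ((EuclideanSpace.proj (𝕜 := ℝ) (2 : Fin 3)).analyticAt _).comp (hUan x (mem_univ _))
  have hθ2 : ContDiff ℝ 2 (fun y => U (-1 + τ) y 2) := hθan.contDiff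
  have hFan : AnalyticOnNhd ℝ F univ := by rw [hF_def]; exact fun x hx => analyticAt_const.mul (hθan x hx)
  have hFω : ContDiff ℝ ω F := hFan.contDiff
  have hF3 : ContDiff ℝ 3 F := hFan.contDiff
  have hF2 : ContDiff ℝ 2 F := hFan.contDiff
  have hFd : Differentiable ℝ F := hF2.differentiable (by norm_num)
  have hFfd : ∀ x w, fderiv ℝ F x w = σ * fderiv ℝ (fun y => U (-1 + τ) y 2) x w := by
    intro x w; rw [hF_def, fderiv_const_mul ((hθ2.differentiable (by norm_num)) x)]; simp
  have hGjoint : ∀ q : EuclideanSpace ℝ (Fin 3), DifferentiableAt ℝ (uncurry fun τ' y => σ * U (-1 + τ') y 2) (τ, q) := fun q => by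
    have h := contDiffOn_uncurry_signed hUrate hUcont hUmild hUdiv σ (n := 1) (T := Ioo (-1 / 2) (1 / 2)) Subset.rfl
    exact (h.differentiableOn (by simp)).differentiableAt
      ((isOpen_Ioo.prod isOpen_univ).mem_nhds ⟨⟨by linarith [(abs_lt.1 hτh).1], by linarith [(abs_lt.1 hτh).2]⟩, mem_univ _⟩)
  /- STEP 2: the web function at time `τ`. -/
  have hS : ∀ z : ℝ, |z| < δ → ∀ s : ℝ, ∃ n₀ ∈ Ioo (-r) r, F (frameCLM e (s, n₀, z)) = R τ z ∧
      ∀ n ∈ Icc (-r) r, n ≠ n₀ → F (frameCLM e (s, n, z)) < R τ z := by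
    intro z hz s
    obtain ⟨n₀, hn₀, hval, huniq, -, -⟩ := hweb τ z hτδ hz s
    refine ⟨n₀, hn₀, ?_, fun n hn hne => ?_⟩
    · rw [hF_def, ← hpt]; exact hval
    · rw [hF_def, ← hpt]; exact huniq n hn hne
  set G : ℝ × ℝ → ℝ := webFun F e r δ (R τ) hS with hG_def
  have hspec : ∀ p : ℝ × ℝ, |p.2| < δ → G p ∈ Ioo (-r) r ∧ F (frameCLM e (p.1, G p, p.2)) = R τ p.2 ∧
      ∀ n ∈ Icc (-r) r, n ≠ G p → F (frameCLM e (p.1, n, p.2)) < R τ p.2 := fun p hp => webFun_spec hS hp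
  have hWpt : ∀ p : ℝ × ℝ, webMap e G p = frameCLM e (p.1, G p, p.2) := fun p => by simp only [webMap, frameCLM_apply]
  have hW2 : ∀ p : ℝ × ℝ, webMap e G p 2 = p.2 := fun p => by rw [hWpt, frameCLM_apply_two he2]
  have hAweb : ∀ p : ℝ × ℝ, |p.2| < δ → DifferentiableAt ℝ (uncurry R) (τ, p.2) ∧
      fderiv ℝ (uncurry fun τ' y => σ * U (-1 + τ') y 2) (τ, webMap e G p) =
        (fderiv ℝ (uncurry R) (τ, p.2)).comp ((ContinuousLinearMap.fst ℝ ℝ (EuclideanSpace ℝ (Fin 3))).prod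
          ((EuclideanSpace.proj (2 : Fin 3)).comp (ContinuousLinearMap.snd ℝ ℝ (EuclideanSpace ℝ (Fin 3))))) := by
    intro p hp
    obtain ⟨n₁, hn₁, hval₁, -, hRd, hfd⟩ := hweb τ p.2 hτδ hp p.1
    have hn : n₁ = G p := by
      by_contra hne
      have hlt := (hspec p hp).2.2 n₁ (Ioo_subset_Icc_self hn₁) hne
      rw [hpt] at hval₁
      simp only [hF_def] at hlt
      exact absurd hval₁ hlt.ne
    refine ⟨hRd, ?_⟩
    rw [hpt, hn] at hfd
    rw [hWpt]; exact hfd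
  -- horizontal criticality at web points
  have hgrad : ∀ p : ℝ × ℝ, |p.2| < δ → fderiv ℝ (U (-1 + τ)) (webMap e G p) (EuclideanSpace.single 0 1) 2 = 0 ∧
      fderiv ℝ (U (-1 + τ)) (webMap e G p) (EuclideanSpace.single 1 1) 2 = 0 := by
    intro p hp
    have h := webData_of_fderiv_uncurry hUrate hUcont hUmild hUdiv hσ hτh (hAweb p hp).2 (hAweb p hp).2 rfl
    exact ⟨h.2.2.2.1, h.2.2.2.2.1⟩
  have hhoriz : ∀ p : ℝ × ℝ, |p.2| < δ → ∀ w : EuclideanSpace ℝ (Fin 3), w 2 = 0 → fderiv ℝ F (webMap e G p) w = 0 := by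
    intro p hp w hw
    rw [hFfd, fderiv_two_horizontal_eq_zero (hUd _) (hgrad p hp).1 (hgrad p hp).2 hw, mul_zero]
  -- strict concavity along `Je`; the web function is `C^ω` on `|z| < δ`
  have hconcF : ∀ z : ℝ, |z| < δ → ∀ s : ℝ, ∀ n ∈ Ioo (-r) r, fderiv ℝ (fderiv ℝ F) (frameCLM e (s, n, z)) (Jvec e) (Jvec e) < 0 := by
    intro z hz s n hn
    have h := hconc τ z hτδ hz s n hn
    rw [← hF_def, hpt, hνe] at h
    exact h
  have hGω : ∀ p : ℝ × ℝ, |p.2| < δ → ContDiffAt ℝ ω G p := fun p hp => contDiffAt_webFun hFω hS hconcF hp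
  /- STEP 3: the vertical gradient on the sheet is the CONSTANT `b` (sonic). -/
  obtain ⟨a, b, hab⟩ := hson
  have habs : ∀ {c : ℝ} {z : ℝ}, z ∈ Ioo (-c) c ↔ |z| < c := fun {c z} => by rw [mem_Ioo, abs_lt]
  have hRz : ∀ z : ℝ, |z| < δ → DifferentiableAt ℝ (uncurry R) (τ, z) → fderiv ℝ (uncurry R) (τ, z) (0, 1) = b := by
    intro z hz hRd
    rw [fderiv_apply_zero_one_eq_deriv hRd]
    have hev : (fun z' : ℝ => uncurry R ((τ, z).1, z')) =ᶠ[𝓝 z] fun z' => a + b * z' := by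
      filter_upwards [isOpen_Ioo.mem_nhds (habs.2 hz : z ∈ Ioo (-δ) δ)] with z' hz'
      simp only [uncurry_apply_pair]
      exact hab z' (habs.1 hz')
    rw [hev.deriv_eq]
    simp
  have hc2 : ∀ p : ℝ × ℝ, |p.2| < δ → fderiv ℝ F (webMap e G p) e2 = b := by
    intro p hp
    obtain ⟨hRd, hfd⟩ := hAweb p hp
    -- `F = (uncurry F̃) ∘ (y ↦ (τ, y))`
    have hcomp : HasFDerivAt F ((fderiv ℝ (uncurry fun τ' y => σ * U (-1 + τ') y 2) (τ, webMap e G p)).comp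
        ((0 : EuclideanSpace ℝ (Fin 3) →L[ℝ] ℝ).prod (ContinuousLinearMap.id ℝ (EuclideanSpace ℝ (Fin 3))))) (webMap e G p) := by
      have hi : HasFDerivAt (fun y : EuclideanSpace ℝ (Fin 3) => ((τ, y) : ℝ × EuclideanSpace ℝ (Fin 3)))
          ((0 : EuclideanSpace ℝ (Fin 3) →L[ℝ] ℝ).prod (ContinuousLinearMap.id ℝ (EuclideanSpace ℝ (Fin 3)))) (webMap e G p) :=
        (hasFDerivAt_const τ _).prodMk (hasFDerivAt_id _)
      have h := (hGjoint (webMap e G p)).hasFDerivAt.comp (webMap e G p) hi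
      have hfun : (uncurry fun τ' y => σ * U (-1 + τ') y 2) ∘ (fun y : EuclideanSpace ℝ (Fin 3) => ((τ, y) : ℝ × EuclideanSpace ℝ (Fin 3))) = F := by
        funext y; simp [hF_def]
      rw [hfun] at h
      exact h
    rw [hcomp.fderiv, hfd]
    simp only [ContinuousLinearMap.comp_apply, ContinuousLinearMap.prod_apply, _root_.zero_apply, ContinuousLinearMap.id_apply,
      ContinuousLinearMap.coe_fst', ContinuousLinearMap.coe_snd']
    have he22 : (EuclideanSpace.proj (2 : Fin 3) : EuclideanSpace ℝ (Fin 3) →L[ℝ] ℝ) e2 = 1 := by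
      show e2 2 = 1
      simp [e2]
    rw [he22]
    exact hRz p.2 hp hRd
  /- STEP 4: the height window: `μ(−1+τ,·) < 0`, inside `δ` and `ρ`. -/
  have hμfun : μ (-1 + τ) = uncurry μ ∘ fun z : ℝ => ((-1 + τ : ℝ), z) := by funext z; rfl
  have hμd : ∀ z : ℝ, DifferentiableAt ℝ (μ (-1 + τ)) z := fun z => by
    rw [hμfun]; exact ((hμ3.differentiable (by norm_num)) _).comp z ((differentiableAt_const _).prodMk differentiableAt_id)
  have hμc : Continuous (μ (-1 + τ)) := by rw [hμfun]; exact hμ3.continuous.comp (continuous_const.prodMk continuous_id)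
  obtain ⟨ε, hε, hεμ⟩ : ∃ ε > 0, ∀ z : ℝ, dist z 0 < ε → μ (-1 + τ) z < 0 :=
    Metric.eventually_nhds_iff.1 (hμc.continuousAt.eventually (gt_mem_nhds hμneg))
  set δ' : ℝ := min ε (min δ ρ) with hδ'
  have hδ'pos : 0 < δ' := lt_min hε (lt_min hδ hρ)
  have hδ'δ : δ' ≤ δ := (min_le_right _ _).trans (min_le_left _ _)
  have hδ'ρ : δ' ≤ ρ := (min_le_right _ _).trans (min_le_right _ _)
  have hδ'ε : δ' ≤ ε := min_le_left _ _
  set I : Set ℝ := Ioo (-δ') δ' with hI_def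
  have hI : ∀ z ∈ I, |z| < δ ∧ |z| < ρ ∧ μ (-1 + τ) z < 0 := fun z hz =>
    ⟨lt_of_lt_of_le (habs.1 hz) hδ'δ, lt_of_lt_of_le (habs.1 hz) hδ'ρ, hεμ z (by simpa using lt_of_lt_of_le (habs.1 hz) hδ'ε)⟩
  /- STEP 5: regularity of `G` on the region; the tube bound. -/
  have hG2 : ContDiffOn ℝ 2 G (region I) := fun p hp => ((hGω p (hI p.2 hp).1).of_le le_top).contDiffWithinAt
  have hGb : ∀ p ∈ region I, |G p| ≤ r := fun p hp => by
    have h := (hspec p (hI p.2 hp).1).1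
    rw [abs_le]; exact ⟨h.1.le, h.2.le⟩
  /- STEP 6: the slice law at time `−1+τ` in the frame `(e, Je, e₂)`. -/
  have hplane : ∀ z : ℝ, |z| < ρ → ∀ y : EuclideanSpace ℝ (Fin 3), y 2 = z → ∀ b' : Fin 3, b' ≠ 2 →
      fderiv ℝ (U (-1 + τ)) y (EuclideanSpace.single 2 (1 : ℝ)) b' = μ (-1 + τ) z * fderiv ℝ (U (-1 + τ)) y (EuclideanSpace.single b' (1 : ℝ)) 2 := by
    intro z hz y hy b' hb'
    have h := hslabU (-1 + τ) hτρ' y (by rw [hy]; exact hz) b' hb'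
    rw [hy] at h; exact h
  have hframe : ∀ x : EuclideanSpace ℝ (Fin 3),
      fderiv ℝ (fderiv ℝ F) x e e + fderiv ℝ (fderiv ℝ F) x (Jvec e) (Jvec e) =
        σ * (fderiv ℝ (fun w => fderiv ℝ (fun y => U (-1 + τ) y 2) w (EuclideanSpace.single 0 (1 : ℝ))) x (EuclideanSpace.single 0 (1 : ℝ)) +
          fderiv ℝ (fun w => fderiv ℝ (fun y => U (-1 + τ) y 2) w (EuclideanSpace.single 1 (1 : ℝ))) x (EuclideanSpace.single 1 (1 : ℝ))) := by
    intro x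
    rw [bilin_frame_trace (fderiv ℝ (fderiv ℝ F) x) he2 hunit, ← nested_eq_fderiv_fderiv hF2, ← nested_eq_fderiv_fderiv hF2,
      hF_def, nested_const_mul hθ2, nested_const_mul hθ2]
    ring
  have hlaw : ∀ x : EuclideanSpace ℝ (Fin 3), x 2 ∈ I →
      fderiv ℝ (fderiv ℝ F) x e2 e2 = -μ (-1 + τ) (x 2) * (fderiv ℝ (fderiv ℝ F) x e e + fderiv ℝ (fderiv ℝ F) x (Jvec e) (Jvec e)) := by
    intro x hx
    have hpw := plane_wave_identity hU2 (fun y => div_coord (hUdiv (-1 + τ) ht) y) (hplane (x 2) (hI _ hx).2.1) (x := x) rfl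
    rw [hframe, ← nested_eq_fderiv_fderiv hF2, hF_def, show e2 = EuclideanSpace.single 2 (1 : ℝ) from rfl, nested_const_mul hθ2, hpw]
    ring
  /- STEP 7: criticality, non-degeneracy and the ridge law on the region. -/
  have hce : ∀ p ∈ region I, fderiv ℝ F (webMap e G p) e = 0 := fun p hp => hhoriz p (hI p.2 hp).1 e he2
  have hcJ : ∀ p ∈ region I, fderiv ℝ F (webMap e G p) (Jvec e) = 0 := fun p hp => hhoriz p (hI p.2 hp).1 (Jvec e) (by simp [Jvec])
  have hc2' : ∀ p ∈ region I, fderiv ℝ F (webMap e G p) e2 = b := fun p hp => hc2 p (hI p.2 hp).1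
  have hA : ∀ p ∈ region I, fderiv ℝ (fderiv ℝ F) (webMap e G p) (Jvec e) (Jvec e) ≠ 0 := fun p hp => by
    rw [hWpt]; exact (hconcF p.2 (hI p.2 hp).1 p.1 (G p) (hspec p (hI p.2 hp).1).1).ne
  set K : ℝ → ℝ := fun z => -(fderiv ℝ (fderiv ℝ F) (webMap e G ((0 : ℝ), z)) e e +
    fderiv ℝ (fderiv ℝ F) (webMap e G ((0 : ℝ), z)) (Jvec e) (Jvec e)) with hK_def
  have hO : IsOpen ({q : ℝ × EuclideanSpace ℝ (Fin 3) | |q.1 + 1| < ρ} ∩ {q | |q.2 2| < ρ}) :=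
    (isOpen_lt (continuous_abs.comp (continuous_fst.add continuous_const)) continuous_const).inter
      (isOpen_lt (continuous_abs.comp ((EuclideanSpace.proj (𝕜 := ℝ) (2 : Fin 3)).continuous.comp continuous_snd)) continuous_const)
  have hridge : ∀ p ∈ region I,
      fderiv ℝ (fderiv ℝ F) (webMap e G p) e e + fderiv ℝ (fderiv ℝ F) (webMap e G p) (Jvec e) (Jvec e) = -K p.2 := by
    intro p hp
    obtain ⟨hzδ, hzρ, hμz⟩ := hI p.2 hp
    have hzδ' : |((0 : ℝ), p.2).2| < δ := hzδ
    have hslopeEv : ∀ y : EuclideanSpace ℝ (Fin 3), y 2 = (webMap e G p) 2 →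
        ∀ᶠ q in 𝓝 ((-1 + τ, y) : ℝ × EuclideanSpace ℝ (Fin 3)), ∀ b' : Fin 3, b' ≠ 2 →
          fderiv ℝ (U q.1) q.2 (EuclideanSpace.single 2 1) b' = μ q.1 (q.2 2) * fderiv ℝ (U q.1) q.2 (EuclideanSpace.single b' 1) 2 := by
      intro y hy
      have hmem : ((-1 + τ : ℝ), y) ∈ ({q : ℝ × EuclideanSpace ℝ (Fin 3) | |q.1 + 1| < ρ} ∩ {q | |q.2 2| < ρ}) := by
        refine ⟨by simpa using hτρ, ?_⟩
        show |y 2| < ρ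
        rw [hy, hW2]; exact hzρ
      exact Filter.eventually_of_mem (hO.mem_nhds hmem) fun q hq => hslabU q.1 hq.1 q.2 hq.2
    have hplane' : ∀ y : EuclideanSpace ℝ (Fin 3), y 2 = (webMap e G p) 2 → ∀ b' : Fin 3, b' ≠ 2 →
        fderiv ℝ (U (-1 + τ)) y (EuclideanSpace.single 2 1) b' =
          μ (-1 + τ) ((webMap e G p) 2) * fderiv ℝ (U (-1 + τ)) y (EuclideanSpace.single b' 1) 2 := by
      intro y hy b' hb'
      rw [hW2]
      exact hplane p.2 hzρ y (by rw [hy, hW2]) b' hb'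
    have hμ1' : μ (-1 + τ) ((webMap e G p) 2) ≠ 1 := by rw [hW2]; linarith
    have hvalEq : σ * U (-1 + τ) (webMap e G p) 2 = σ * U (-1 + τ) (webMap e G ((0 : ℝ), p.2)) 2 := by
      have h1 : F (webMap e G p) = R τ p.2 := by rw [hWpt]; exact (hspec p hzδ).2.1
      have h2 : F (webMap e G ((0 : ℝ), p.2)) = R τ p.2 := by rw [hWpt]; exact (hspec ((0 : ℝ), p.2) hzδ').2.1
      rw [hF_def] at h1 h2
      simp only at h1 h2
      rw [h1, h2]
    have h := horizLaplacian_two_eq_of_webFermat hUrate hUcont hUmild hUdiv hUpol hμ3 hτh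
      (p := webMap e G p) (p' := webMap e G ((0 : ℝ), p.2)) (by rw [hW2, hW2]) hslopeEv hplane' hμ1' hσ
      (hAweb p hzδ).2 (hAweb ((0 : ℝ), p.2) hzδ').2 hvalEq
    rw [hK_def]; simp only
    rw [hframe, hframe, h, neg_neg]
  /- STEP 8: differentiability of `μ(−1+τ,·)` and `K` on the window. -/
  have hμ' : ∀ z ∈ I, HasDerivAt (μ (-1 + τ)) (deriv (μ (-1 + τ)) z) z := fun z _ => (hμd z).hasDerivAt
  have hK' : ∀ z ∈ I, HasDerivAt K (deriv K z) z := by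
    intro z hz
    have hp : ((0 : ℝ), z) ∈ region I := hz
    have hGd : DifferentiableAt ℝ G ((0 : ℝ), z) := (hG2.contDiffAt ((isOpen_region isOpen_Ioo).mem_nhds hp)).differentiableAt (by norm_num)
    have h1 := (differentiableAt_hess_comp (e := e) hF3 hGd e e).comp z ((differentiableAt_const _).prodMk differentiableAt_id)
    have h2 := (differentiableAt_hess_comp (e := e) hF3 hGd (Jvec e) (Jvec e)).comp z ((differentiableAt_const _).prodMk differentiableAt_id)
    have hKd : DifferentiableAt ℝ K z := by
      rw [hK_def]
      exact (h1.add h2).neg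
    exact hKd.hasDerivAt
  /- STEP 9: the graph transport law ⇒ the webs are parallel lines, `d′² = −μ`. -/
  obtain ⟨hpar, hd⟩ := sfree_of_sonic_sheet hF3 he2 isOpen_Ioo hG2 hμ' hK' (fun z hz => (hI z hz).2.2) hlaw hce hcJ hc2' hridge hA hGb
  refine ⟨δ', fun z => G (0, z), hδ'pos, hδ'δ, fun s z hz => ?_, fun z hz => ⟨?_, hd z hz⟩⟩
  · have hzδ : |z| < δ := (hI z hz).1
    have hp : ((s, z) : ℝ × ℝ) ∈ region I := hz
    obtain ⟨hGr, hval, huniq⟩ := hspec (s, z) hzδ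
    have hG0 : G (s, z) = G (0, z) := hpar (s, z) hp
    rw [hG0] at hGr hval huniq
    rw [hF_def] at hval huniq
    simp only at hGr hval huniq ⊢
    refine ⟨hGr, ?_, fun n hn hne => ?_⟩
    · rw [hpt]; exact hval
    · rw [hpt]; exact huniq n hn hne
  · have hp : ((0 : ℝ), z) ∈ region I := hz
    exact ((hG2.contDiffAt ((isOpen_region isOpen_Ioo).mem_nhds hp)).differentiableAt (by norm_num)).comp z
      ((differentiableAt_const _).prodMk differentiableAt_id)

/-- ★ **B-T in the currency of port-2's space–time web function** (`…Q4TimeWebPackage.time_web_package_line`, input «PARALLEL AT τ» of the A-SPEED(τ)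
package): under the hypotheses of `sonic_webs_parallel`, ANY cross-section maximiser `n₀(τ, s, z)` (value `R(τ,z)` at `frameCLM (Γ′0) (s, n₀, z)`,
`n₀ ∈ (−r, r)`) on a height window is `s`-free on a (possibly smaller) height window: `n₀(τ,s,z) = n₀(τ,0,z)`. -/
theorem sonic_webs_parallel_timeWeb {C : ℝ} {U : ℝ → EuclideanSpace ℝ (Fin 3) → EuclideanSpace ℝ (Fin 3)} {Γ νΓ : ℝ → EuclideanSpace ℝ (Fin 3)}
    {R μ : ℝ → ℝ → ℝ} {σ r δ ρ τ δ₀ : ℝ} {n₀ : ℝ × ℝ × ℝ → ℝ}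
    (hUrate : HasTypeITimeDecay C U) (hUcont : ContinuousOn (uncurry U) (Iio (0 : ℝ) ×ˢ univ))
    (hUmild : ∀ s t : ℝ, s < t → t < 0 → ∀ x, U t x = heatExtension (U s) (t - s) x - oseenDuhamel 1 s U U t x)
    (hUdiv : ∀ t < 0, VectorCalculus.IsDivFree (U t))
    (hUpol : ∀ s < 0, ∀ q, ⟪curl (U s) q, EuclideanSpace.single 2 1⟫_ℝ = 0)
    (hσ : σ = 1 ∨ σ = -1)
    (hΓ2 : ∀ s, Γ s 2 = 0) (hΓunit : ∀ s, ‖deriv Γ s‖ = 1)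
    (hν : ∀ s, νΓ s = WithLp.toLp 2 ![-(deriv Γ s 1), deriv Γ s 0, 0])
    (hline : ∀ s : ℝ, Γ s = s • deriv Γ 0)
    (hδ : 0 < δ)
    (hconc : ∀ τ z : ℝ, |τ| < δ → |z| < δ → ∀ s : ℝ, ∀ n ∈ Ioo (-r) r,
      fderiv ℝ (fderiv ℝ (fun y => σ * U (-1 + τ) y 2)) (Γ s + n • νΓ s + z • EuclideanSpace.single 2 (1 : ℝ)) (νΓ s) (νΓ s) < 0)
    (hweb : ∀ τ₀ z₀ : ℝ, |τ₀| < δ → |z₀| < δ → ∀ s₀ : ℝ, ∃ n₀ ∈ Ioo (-r) r,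
      σ * U (-1 + τ₀) (Γ s₀ + n₀ • νΓ s₀ + z₀ • EuclideanSpace.single 2 (1 : ℝ)) 2 = R τ₀ z₀ ∧
      (∀ n ∈ Icc (-r) r, n ≠ n₀ → σ * U (-1 + τ₀) (Γ s₀ + n • νΓ s₀ + z₀ • EuclideanSpace.single 2 (1 : ℝ)) 2 < R τ₀ z₀) ∧
      DifferentiableAt ℝ (uncurry R) (τ₀, z₀) ∧
      fderiv ℝ (uncurry fun τ y => σ * U (-1 + τ) y 2) (τ₀, Γ s₀ + n₀ • νΓ s₀ + z₀ • EuclideanSpace.single 2 (1 : ℝ)) =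
        (fderiv ℝ (uncurry R) (τ₀, z₀)).comp
          ((ContinuousLinearMap.fst ℝ ℝ (EuclideanSpace ℝ (Fin 3))).prod
            ((EuclideanSpace.proj (2 : Fin 3)).comp (ContinuousLinearMap.snd ℝ ℝ (EuclideanSpace ℝ (Fin 3))))))
    (hρ : 0 < ρ) (hμ3 : ContDiff ℝ 3 (uncurry μ))
    (hslabU : ∀ t : ℝ, |t + 1| < ρ → ∀ x : EuclideanSpace ℝ (Fin 3), |x 2| < ρ → ∀ b : Fin 3, b ≠ 2 →
      fderiv ℝ (U t) x (EuclideanSpace.single 2 1) b = μ t (x 2) * fderiv ℝ (U t) x (EuclideanSpace.single b 1) 2)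
    (hτδ : |τ| < δ) (hτρ : |τ| < ρ) (hτh : |τ| < 1 / 2)
    (hson : ∃ a b : ℝ, ∀ z : ℝ, |z| < δ → R τ z = a + b * z) (hμneg : μ (-1 + τ) 0 < 0)
    (hδ₀ : 0 < δ₀)
    (hn₀ : ∀ s z : ℝ, |z| < δ₀ → n₀ (τ, s, z) ∈ Ioo (-r) r ∧
      σ * U (-1 + τ) (frameCLM (deriv Γ 0) (s, n₀ (τ, s, z), z)) 2 = R τ z) :
    ∃ δ₁ : ℝ, 0 < δ₁ ∧ δ₁ ≤ δ₀ ∧ δ₁ ≤ δ ∧ ∀ s z : ℝ, |z| < δ₁ → n₀ (τ, s, z) = n₀ (τ, 0, z) := by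
  obtain ⟨δ', d, hδ', hδ'δ, hmax, -⟩ := sonic_webs_parallel hUrate hUcont hUmild hUdiv hUpol hσ hΓ2 hΓunit hν hline hδ hconc hweb hρ hμ3 hslabU
    hτδ hτρ hτh hson hμneg
  obtain ⟨-, -, -, -, hpt⟩ := line_frame hline hΓ2 hΓunit hν
  refine ⟨min δ' δ₀, lt_min hδ' hδ₀, min_le_right _ _, (min_le_left _ _).trans hδ'δ, fun s z hz => ?_⟩
  have hz' : z ∈ Ioo (-δ') δ' := by
    rw [mem_Ioo, ← abs_lt]; exact lt_of_lt_of_le hz (min_le_left _ _)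
  have hz₀ : |z| < δ₀ := lt_of_lt_of_le hz (min_le_right _ _)
  -- both `n₀(τ,s,z)` and `n₀(τ,0,z)` are maximisers, hence equal to `d z`
  have key : ∀ s' : ℝ, n₀ (τ, s', z) = d z := by
    intro s'
    obtain ⟨hmem, hval⟩ := hn₀ s' z hz₀
    obtain ⟨-, -, huniq⟩ := hmax s' z hz'
    by_contra hne
    have hlt := huniq (n₀ (τ, s', z)) (Ioo_subset_Icc_self hmem) hne
    rw [hpt] at hlt
    exact absurd hval hlt.ne
  rw [key s, key 0]

end Summit.NavierStokesRegularity.NavierStokesRegularity.Theorems.PoloidalWindowDoorLrcModEntireSonicWebsParallel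

end
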